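/-
Copyright: b2b-lace packet (LEAN TYPING SEAT 1 gen 35, node KU-SEP-ROW-ENCL, a leaf under KU-SEP-RED /
KU-SEP-GLUE / KU-SEP-Q2). The K/U/KM₂ separable-majorant rows `F(x) ≤ B·Tw(x;0) + c·Sq(x) + Σ_r a_r Tw(x;b_r)`
turned into statements a kernel-decided literal inequality consumes: ENCLOSURES of the mass, of the second
moment and of the six twisted seeds in, one number out (sign-robust in the coefficients); the second moment
at an axis node in plain seeds (exact, and m-UNIFORM by coordinatewise monotonicity); the m-uniform `K_{n,0}`
row assembled. d-generic; number-free apart from the landed coefficient record `gset`; def-free; what-if /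
input-certification lane SUPPORT; nothing here is a certificate; no statement at any fixed dimension.
-/
import Literature.Probability.FitznerVanDerHofstad2017.SrwTrigMajorantPolyWeight
import Literature.Probability.FitznerVanDerHofstad2017.SrwIntegralM2X
import Literature.Probability.FitznerVanDerHofstad2017.SrwIntegralMonotone
import HarnessLib

/-!
# The separable-majorant rows with enclosed inputs

CITATION HEADER (PLACEMENT v2). Part of the certified REPRODUCTION of the numerical inputs of
R. Fitzner, R. van der Hofstad, *Generalized approach to the non-backtracking lace expansion*,
Probab. Theory Related Fields 169 (2017) 1041–1119 [NoBLE17-I] (arXiv:1506.07969): the SRW integrals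
`K_{n,l}`, `U_{n,l}` of (3.36)–(3.38) p. 1071 and their evaluation §5.1 (5.2)–(5.9), (5.14)–(5.16)
pp. 1089–1092.  The tree bounds them WITHOUT quadrature by a separable trigonometric majorant
`|t| ≤ B + c t² + Σ_r a_r cos(b_r t)` (`srwK_le_of_trigMajorant`, `srwU_le_of_trigMajorant`,
`srwKM2_le_of_trigMajorant_of_le`; literal coefficients `gset`: `srwK_le_gset`, `srwU_le_gset`,
`srwKM2_le_gset`).  Nothing in this file is a claim of the paper beyond those formulas; everything is PROVED.

## What this module adds

The majorant rows bound `F(x)` (`F = K_{n,l}, U_{n,l}, KM₂`) by `B·Tw^w_n(x;0) + c·Sq^w_n(x) + Σ_r a_r·Tw^w_n(x;b_r)`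
— three kinds of REAL inputs: the weight mass `Tw^w_n(x;0)`, the second moment `Sq^w_n(x)` and the twisted
seeds at the six abscissae `b_r`.  The certificate kernels deliver those inputs as ENCLOSURES (`lo ≤ · ≤ hi`,
`SrwTwistSeedCertRowBound`, `SrwTwistSeedEnclD10…`) or, for far nodes, as `main term ± error` uniformly in
`m` (`SrwTwistTruncationSeeds`, `SrwTwistProductSliceBudget`).  Here the rows are restated over such inputs:

* `srwK_le_encl_of_trigMajorant`, `srwU_le_encl_of_trigMajorant`, `srwKM2_le_encl_of_trigMajorant` — for
  ANY coefficient set with `0 ≤ c`: enclosures `Tlo ≤ Tw(x;0) ≤ Thi`, `Sq(x) ≤ S̄`, `lo_r ≤ Tw(x;b_r) ≤ hi_r`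
  give `F(x) ≤ max(B·Tlo, B·Thi) + c·S̄ + Σ_r max(a_r lo_r, a_r hi_r)` (no sign assumption on `B`, `a_r`);
* `srwK_le_gset_encl_cast`, `srwU_le_gset_encl_cast`, `srwKM2_le_gset_encl_cast` — the same with the
  landed literal coefficients `gset` and RATIONAL enclosures: the right-hand side ONE rational expression
  cast to `ℝ`;
* `srwSqMom_abs_Dhat_pow_even_single_eq` — the second moment with weight `|D̂|^{2l}` at an axis node in
  plain seeds, `Sq_n(m e_i) = (I_{n,2l}(0) + I_{n,2l}(2m e_i))/(2d) + ((d−1)/d)·I_{n,2l}(m e_i + m e_j)`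
  (`integral_abs_Dhat_pow_even_mul_DhatSym_single_sq`, KU-SEP-Q2), and `…_single_le_of_le` — for EVERY
  `|m| ≥ M` at once, `Sq_n(m e_i) ≤ (Ī₀ + Ī₂)/(2d) + ((d−1)/d)·Ī₁₁` from seed bounds at `2M e_i`, `M e_i + M e_j`
  (coordinatewise monotonicity `absMonotone_srwI`, `n ≥ 1`);
* `srwTwist_abs_Dhat_pow_zero`, `srwSqMom_abs_Dhat_pow_zero`, `srwTwist_one_zero_eq_srwI` — the `l = 0`
  weight is the unit weight, and its mass is `I_{n,0}(0)`;
* `srwK_zero_single_le_uniform_of_trigMajorant` (+ `_gset_cast`) — the m-UNIFORM `K_{n,0}` row assembled: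
  from `Tlo ≤ I_{n,0}(0) ≤ Thi`, the two seed bounds at `M`, and per abscissa a uniform device output
  `|Tw_n(m e_i; b_r) − Q_r·I_{n,0}(0)| ≤ E_r`, for every `|m| ≥ M`:
  `K_{n,0}(m e_i) ≤ max(B Tlo, B Thi) + c·((Thi + Ī₂)/(2d) + ((d−1)/d) Ī₁₁) + Σ_r (max(a_r Q_r Tlo, a_r Q_r Thi) + |a_r| E_r)`.

Everything is PROVED (standard axioms), generic in the dimension `d` and def-free; the only numbers are the
landed coefficient record `gset` (referred to by name, never restated).  No instance, no table, no named
fact.  Epistemic status / lane: what-if / input-certification SUPPORT; nothing here is a certificate; no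
statement at a specific dimension.

## References
* R. Fitzner, R. van der Hofstad, *Generalized approach to the non-backtracking lace expansion*,
  PTRF 169 (2017) 1041–1119 (arXiv:1506.07969), (3.34)–(3.38) p. 1071, §5.1 (5.2)–(5.9) pp. 1089–1092,
  (5.14)–(5.16) p. 1092. [FitznerVanDerHofstad2016NoBLE]
[cite: FitznerVanDerHofstad2016NoBLE, (3.34)–(3.38) p. 1071, (5.4)–(5.9) pp. 1091–1092, (5.14)–(5.16) p. 1092]
-/

noncomputable section

open MeasureTheory Real Finset
open scoped BigOperators

namespace Literature.Probability.FitznerVanDerHofstad2017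

open TrigEncl
open Literature.Barriers.CriticalPhenomena
open Literature.Barriers.CriticalPhenomena.Slade2006Prop53 (P)

variable {d : ℕ}

/-! ### Sign-robust enclosure algebra -/

/-- `a·t ≤ max(a·lo, a·hi)` for `lo ≤ t ≤ hi`, whatever the sign of `a`. [folklore] -/
private theorem mul_le_max_mul_of_mem {a t lo hi : ℝ} (h1 : lo ≤ t) (h2 : t ≤ hi) :
    a * t ≤ max (a * lo) (a * hi) := by
  rcases le_total 0 a with ha | ha
  · exact (mul_le_mul_of_nonneg_left h2 ha).trans (le_max_right _ _)
  · exact (mul_le_mul_of_nonpos_left h1 ha).trans (le_max_left _ _)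

/-- The row `K ≤ B·T + c·S + Σ_r a_r Tw_r` under enclosures of `T`, `S` (upper, `c ≥ 0`) and the `Tw_r`.
[folklore] -/
private theorem row_le_of_encl {R : ℕ} {B c K T S Tlo Thi Shi : ℝ} {a Tw lo hi : Fin R → ℝ}
    (hK : K ≤ B * T + c * S + ∑ r, a r * Tw r) (hc : 0 ≤ c)
    (hT : Tlo ≤ T ∧ T ≤ Thi) (hS : S ≤ Shi) (hr : ∀ r, lo r ≤ Tw r ∧ Tw r ≤ hi r) :
    K ≤ max (B * Tlo) (B * Thi) + c * Shi + ∑ r, max (a r * lo r) (a r * hi r) :=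
  hK.trans (add_le_add (add_le_add (mul_le_max_mul_of_mem hT.1 hT.2)
    (mul_le_mul_of_nonneg_left hS hc)) (sum_le_sum fun r _ => mul_le_max_mul_of_mem (hr r).1 (hr r).2))

/-- The m-uniform row: `K ≤ B·T + c·S + Σ_r a_r Tw_r` with `|Tw_r − Q_r·T| ≤ E_r`. [folklore] -/
private theorem row_le_of_uniform {R : ℕ} {B c K T S Tlo Thi Shi : ℝ} {a Tw Q E : Fin R → ℝ}
    (hK : K ≤ B * T + c * S + ∑ r, a r * Tw r) (hc : 0 ≤ c)
    (hT : Tlo ≤ T ∧ T ≤ Thi) (hS : S ≤ Shi) (hr : ∀ r, |Tw r - Q r * T| ≤ E r) :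
    K ≤ max (B * Tlo) (B * Thi) + c * Shi
      + ∑ r, (max (a r * Q r * Tlo) (a r * Q r * Thi) + |a r| * E r) := by
  refine hK.trans (add_le_add (add_le_add (mul_le_max_mul_of_mem hT.1 hT.2)
    (mul_le_mul_of_nonneg_left hS hc)) (sum_le_sum fun r _ => ?_))
  have h1 : a r * Tw r = a r * Q r * T + a r * (Tw r - Q r * T) := by ring
  have h2 : a r * (Tw r - Q r * T) ≤ |a r| * E r :=
    (le_abs_self _).trans (by rw [abs_mul]; exact mul_le_mul_of_nonneg_left (hr r) (abs_nonneg _))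
  rw [h1]
  exact add_le_add (mul_le_max_mul_of_mem hT.1 hT.2) h2

/-! ### The rows with enclosed inputs, any coefficient set -/

/-- **`K_{n,l}(x)` from enclosures.** For `d ≥ 2n+1`, a majorant `|t| ≤ B + c t² + Σ_r a_r cos(b_r t)` on
`[-1,1]` with `0 ≤ c`, and enclosures of the mass, the second moment and the twisted seeds of the weight
`|D̂|^l`: `K_{n,l}(x) ≤ max(B·Tlo, B·Thi) + c·S̄ + Σ_r max(a_r lo_r, a_r hi_r)`.
[cite: FitznerVanDerHofstad2016NoBLE, (3.36) p. 1071; (5.9) p. 1092] -/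
theorem srwK_le_encl_of_trigMajorant {n : ℕ} (hd : 2 * n + 1 ≤ d) (l : ℕ) (x : Fin d → ℤ) {R : ℕ}
    (B c : ℝ) (a b : Fin R → ℝ)
    (hmaj : ∀ t ∈ Set.Icc (-1 : ℝ) 1, |t| ≤ B + c * t ^ 2 + ∑ r, a r * Real.cos (b r * t))
    (hc : 0 ≤ c) {Tlo Thi Shi : ℝ} {lo hi : Fin R → ℝ}
    (hT : Tlo ≤ srwTwist d n (fun k => |Dhat d k| ^ l) x 0 ∧ srwTwist d n (fun k => |Dhat d k| ^ l) x 0 ≤ Thi)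
    (hS : srwSqMom d n (fun k => |Dhat d k| ^ l) x ≤ Shi)
    (hr : ∀ r, lo r ≤ srwTwist d n (fun k => |Dhat d k| ^ l) x (b r)
      ∧ srwTwist d n (fun k => |Dhat d k| ^ l) x (b r) ≤ hi r) :
    srwK d n l x ≤ max (B * Tlo) (B * Thi) + c * Shi + ∑ r, max (a r * lo r) (a r * hi r) :=
  row_le_of_encl (srwK_le_of_trigMajorant hd l x B c a b hmaj) hc hT hS hr

/-- **`U_{n,l}(x)` from enclosures** (weight `|D̂|^l D̂^{sin}`).
[cite: FitznerVanDerHofstad2016NoBLE, (3.38) p. 1071; (5.9) p. 1092] -/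
theorem srwU_le_encl_of_trigMajorant {n : ℕ} (hd : 2 * n + 1 ≤ d) (l : ℕ) (x : Fin d → ℤ) {R : ℕ}
    (B c : ℝ) (a b : Fin R → ℝ)
    (hmaj : ∀ t ∈ Set.Icc (-1 : ℝ) 1, |t| ≤ B + c * t ^ 2 + ∑ r, a r * Real.cos (b r * t))
    (hc : 0 ≤ c) {Tlo Thi Shi : ℝ} {lo hi : Fin R → ℝ}
    (hT : Tlo ≤ srwTwist d n (fun k => |Dhat d k| ^ l * Dsin d k) x 0
      ∧ srwTwist d n (fun k => |Dhat d k| ^ l * Dsin d k) x 0 ≤ Thi)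
    (hS : srwSqMom d n (fun k => |Dhat d k| ^ l * Dsin d k) x ≤ Shi)
    (hr : ∀ r, lo r ≤ srwTwist d n (fun k => |Dhat d k| ^ l * Dsin d k) x (b r)
      ∧ srwTwist d n (fun k => |Dhat d k| ^ l * Dsin d k) x (b r) ≤ hi r) :
    srwU d n l x ≤ max (B * Tlo) (B * Thi) + c * Shi + ∑ r, max (a r * lo r) (a r * hi r) :=
  row_le_of_encl (srwU_le_of_trigMajorant hd l x B c a b hmaj) hc hT hS hr

/-- **`KM₂_{n,l}(x)` from enclosures** (weight `|D̂|^l M̂²`).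
[cite: FitznerVanDerHofstad2016NoBLE, (3.36)–(3.37) p. 1071; (5.9), (5.14) p. 1092] -/
theorem srwKM2_le_encl_of_trigMajorant {n : ℕ} (hd : 2 * n + 1 ≤ d) (l : ℕ) (x : Fin d → ℤ) {R : ℕ}
    (B c : ℝ) (a b : Fin R → ℝ)
    (hmaj : ∀ t ∈ Set.Icc (-1 : ℝ) 1, |t| ≤ B + c * t ^ 2 + ∑ r, a r * Real.cos (b r * t))
    (hc : 0 ≤ c) {Tlo Thi Shi : ℝ} {lo hi : Fin R → ℝ}
    (hT : Tlo ≤ srwTwist d n (fun k => |Dhat d k| ^ l * Mhat d k ^ 2) x 0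
      ∧ srwTwist d n (fun k => |Dhat d k| ^ l * Mhat d k ^ 2) x 0 ≤ Thi)
    (hS : srwSqMom d n (fun k => |Dhat d k| ^ l * Mhat d k ^ 2) x ≤ Shi)
    (hr : ∀ r, lo r ≤ srwTwist d n (fun k => |Dhat d k| ^ l * Mhat d k ^ 2) x (b r)
      ∧ srwTwist d n (fun k => |Dhat d k| ^ l * Mhat d k ^ 2) x (b r) ≤ hi r) :
    srwKM2 d n l x ≤ max (B * Tlo) (B * Thi) + c * Shi + ∑ r, max (a r * lo r) (a r * hi r) :=
  row_le_of_encl (srwKM2_le_of_trigMajorant_of_le hd l x (fun _ => le_rfl)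
    ((continuous_Dhat d).measurable.abs.pow_const l) (fun k => abs_Dhat_pow_le_one l k) B c a b hmaj)
    hc hT hS hr

/-! ### The rows with the literal coefficients `gset` and rational enclosures -/

/-- `0 ≤ c` for the landed coefficient record `gset` (`c = 199/250`). [folklore] -/
private theorem gset_c_nonneg : (0 : ℝ) ≤ (MajCert.gset.c : ℝ) := by
  have h : (0 : ℚ) ≤ MajCert.gset.c := by norm_num [MajCert.gset]
  exact_mod_cast h

/-- **`K_{n,l}(x)` from rational enclosures, literal coefficients.** With `gset` (`srwK_le_gset`) and
`Tlo, Thi, S̄, lo_r, hi_r ∈ ℚ`: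
`K_{n,l}(x) ≤ ((max(B Tlo, B Thi) + c S̄ + Σ_{r<6} max(a_r lo_r, a_r hi_r) : ℚ) : ℝ)` — one rational expression.
[cite: FitznerVanDerHofstad2016NoBLE, (3.36) p. 1071; (5.9) p. 1092; §5.1.2 (5.11)–(5.16) pp. 1091–1092] -/
theorem srwK_le_gset_encl_cast {n : ℕ} (hd : 2 * n + 1 ≤ d) (l : ℕ) (x : Fin d → ℤ)
    {Tlo Thi Shi : ℚ} {lo hi : Fin 6 → ℚ}
    (hT : (Tlo : ℝ) ≤ srwTwist d n (fun k => |Dhat d k| ^ l) x 0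
      ∧ srwTwist d n (fun k => |Dhat d k| ^ l) x 0 ≤ (Thi : ℝ))
    (hS : srwSqMom d n (fun k => |Dhat d k| ^ l) x ≤ (Shi : ℝ))
    (hr : ∀ r, (lo r : ℝ) ≤ srwTwist d n (fun k => |Dhat d k| ^ l) x (gsetB r)
      ∧ srwTwist d n (fun k => |Dhat d k| ^ l) x (gsetB r) ≤ (hi r : ℝ)) :
    srwK d n l x ≤ ((max (MajCert.gset.B * Tlo) (MajCert.gset.B * Thi) + MajCert.gset.c * Shi
      + ∑ r : Fin 6, max (MajCert.gset.a r * lo r) (MajCert.gset.a r * hi r) : ℚ) : ℝ) := by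
  have h := srwK_le_encl_of_trigMajorant hd l x _ _ gsetA gsetB abs_le_trigMaj_gset gset_c_nonneg
    hT hS hr
  simp only [gsetA] at h
  push_cast
  exact h

/-- **`U_{n,l}(x)` from rational enclosures, literal coefficients** (weight `|D̂|^l D̂^{sin}`).
[cite: FitznerVanDerHofstad2016NoBLE, (3.38) p. 1071; (5.9) p. 1092; §5.1.2 (5.11)–(5.16) pp. 1091–1092] -/
theorem srwU_le_gset_encl_cast {n : ℕ} (hd : 2 * n + 1 ≤ d) (l : ℕ) (x : Fin d → ℤ)
    {Tlo Thi Shi : ℚ} {lo hi : Fin 6 → ℚ}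
    (hT : (Tlo : ℝ) ≤ srwTwist d n (fun k => |Dhat d k| ^ l * Dsin d k) x 0
      ∧ srwTwist d n (fun k => |Dhat d k| ^ l * Dsin d k) x 0 ≤ (Thi : ℝ))
    (hS : srwSqMom d n (fun k => |Dhat d k| ^ l * Dsin d k) x ≤ (Shi : ℝ))
    (hr : ∀ r, (lo r : ℝ) ≤ srwTwist d n (fun k => |Dhat d k| ^ l * Dsin d k) x (gsetB r)
      ∧ srwTwist d n (fun k => |Dhat d k| ^ l * Dsin d k) x (gsetB r) ≤ (hi r : ℝ)) :
    srwU d n l x ≤ ((max (MajCert.gset.B * Tlo) (MajCert.gset.B * Thi) + MajCert.gset.c * Shi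
      + ∑ r : Fin 6, max (MajCert.gset.a r * lo r) (MajCert.gset.a r * hi r) : ℚ) : ℝ) := by
  have h := srwU_le_encl_of_trigMajorant hd l x _ _ gsetA gsetB abs_le_trigMaj_gset gset_c_nonneg
    hT hS hr
  simp only [gsetA] at h
  push_cast
  exact h

/-- **`KM₂_{n,l}(x)` from rational enclosures, literal coefficients** (weight `|D̂|^l M̂²`).
[cite: FitznerVanDerHofstad2016NoBLE, (3.36)–(3.37) p. 1071; (5.9), (5.14) p. 1092; §5.1.2 (5.11)–(5.16) pp. 1091–1092] -/
theorem srwKM2_le_gset_encl_cast {n : ℕ} (hd : 2 * n + 1 ≤ d) (l : ℕ) (x : Fin d → ℤ)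
    {Tlo Thi Shi : ℚ} {lo hi : Fin 6 → ℚ}
    (hT : (Tlo : ℝ) ≤ srwTwist d n (fun k => |Dhat d k| ^ l * Mhat d k ^ 2) x 0
      ∧ srwTwist d n (fun k => |Dhat d k| ^ l * Mhat d k ^ 2) x 0 ≤ (Thi : ℝ))
    (hS : srwSqMom d n (fun k => |Dhat d k| ^ l * Mhat d k ^ 2) x ≤ (Shi : ℝ))
    (hr : ∀ r, (lo r : ℝ) ≤ srwTwist d n (fun k => |Dhat d k| ^ l * Mhat d k ^ 2) x (gsetB r)
      ∧ srwTwist d n (fun k => |Dhat d k| ^ l * Mhat d k ^ 2) x (gsetB r) ≤ (hi r : ℝ)) :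
    srwKM2 d n l x ≤ ((max (MajCert.gset.B * Tlo) (MajCert.gset.B * Thi) + MajCert.gset.c * Shi
      + ∑ r : Fin 6, max (MajCert.gset.a r * lo r) (MajCert.gset.a r * hi r) : ℚ) : ℝ) := by
  have h := srwKM2_le_encl_of_trigMajorant hd l x _ _ gsetA gsetB abs_le_trigMaj_gset gset_c_nonneg
    hT hS hr
  simp only [gsetA] at h
  push_cast
  exact h

/-! ### The second moment at an axis node in plain seeds; m-uniform form -/

/-- **The second moment with weight `|D̂|^{2l}` at an axis node** (KU-SEP-Q2): for `d ≥ 2n+1`, `i ≠ j`,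
any `m : ℤ`, `Sq_n(m e_i) = (I_{n,2l}(0) + I_{n,2l}(2m e_i))/(2d) + ((d−1)/d)·I_{n,2l}(m e_i + m e_j)`.
[cite: FitznerVanDerHofstad2016NoBLE, (5.4), (5.7) p. 1091; (3.34)–(3.35) p. 1071] -/
theorem srwSqMom_abs_Dhat_pow_even_single_eq {n : ℕ} (hd : 2 * n + 1 ≤ d) (l : ℕ) {i j : Fin d}
    (hij : i ≠ j) (m : ℤ) :
    srwSqMom d n (fun k => |Dhat d k| ^ (2 * l)) (Pi.single i m)
      = (srwI d n (2 * l) 0 + srwI d n (2 * l) (Pi.single i (2 * m))) / (2 * d)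
        + ((d : ℝ) - 1) / d * srwI d n (2 * l) (Pi.single i m + Pi.single j m) := by
  rw [srwSqMom]
  exact integral_abs_Dhat_pow_even_mul_DhatSym_single_sq hd l hij m

/-- **m-uniform second moment.** For `n ≥ 1`, `d ≥ 2n+1`, `i ≠ j` and EVERY `m` with `|m| ≥ M`: if
`I_{n,2l}(0) ≤ Ī₀`, `I_{n,2l}(2M e_i) ≤ Ī₂`, `I_{n,2l}(M e_i + M e_j) ≤ Ī₁₁`, then
`Sq_n(m e_i) ≤ (Ī₀ + Ī₂)/(2d) + ((d−1)/d)·Ī₁₁` (the seeds decrease coordinatewise in `|x_μ|`,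
`absMonotone_srwI`). [cite: FitznerVanDerHofstad2016NoBLE, (5.4), (5.7) p. 1091, Lemma 5.1 p. 1093] -/
theorem srwSqMom_abs_Dhat_pow_even_single_le_of_le {n : ℕ} (hn : 1 ≤ n) (hd : 2 * n + 1 ≤ d) (l : ℕ)
    {i j : Fin d} (hij : i ≠ j) (M : ℕ) {m : ℤ} (hM : M ≤ m.natAbs) {I0 I2 I11 : ℝ}
    (h0 : srwI d n (2 * l) 0 ≤ I0) (h2 : srwI d n (2 * l) (Pi.single i (2 * (M : ℤ))) ≤ I2)
    (h11 : srwI d n (2 * l) (Pi.single i (M : ℤ) + Pi.single j (M : ℤ)) ≤ I11) :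
    srwSqMom d n (fun k => |Dhat d k| ^ (2 * l)) (Pi.single i m)
      ≤ (I0 + I2) / (2 * d) + ((d : ℝ) - 1) / d * I11 := by
  have hd1 : 1 ≤ d := by omega
  have hmono := absMonotone_srwI (d := d) hn hd (2 * l)
  have hMm : |(M : ℤ)| ≤ |m| := by
    rw [Int.abs_natCast, ← Int.natCast_natAbs]; exact_mod_cast hM
  have h2' : srwI d n (2 * l) (Pi.single i (2 * m)) ≤ srwI d n (2 * l) (Pi.single i (2 * (M : ℤ))) := by
    refine hmono _ _ fun μ => ?_
    by_cases hμ : μ = i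
    · subst hμ; simp only [Pi.single_eq_same, abs_mul]; exact mul_le_mul_of_nonneg_left hMm (abs_nonneg _)
    · simp [Pi.single_eq_of_ne hμ]
  have h11' : srwI d n (2 * l) (Pi.single i m + Pi.single j m)
      ≤ srwI d n (2 * l) (Pi.single i (M : ℤ) + Pi.single j (M : ℤ)) := by
    refine hmono _ _ fun μ => ?_
    by_cases hμ : μ = i
    · subst hμ
      simp only [Pi.add_apply, Pi.single_eq_same, Pi.single_eq_of_ne hij, add_zero]
      exact hMm
    · by_cases hμ' : μ = j
      · subst hμ'
        simp only [Pi.add_apply, Pi.single_eq_same, Pi.single_eq_of_ne hμ, zero_add]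
        exact hMm
      · simp [Pi.single_eq_of_ne hμ, Pi.single_eq_of_ne hμ']
  have hcoef : 0 ≤ ((d : ℝ) - 1) / d := by
    apply div_nonneg _ (Nat.cast_nonneg _)
    have : (1 : ℝ) ≤ d := by exact_mod_cast hd1
    linarith
  have hd0 : (0 : ℝ) < 2 * d := by
    have : (1 : ℝ) ≤ d := by exact_mod_cast hd1
    linarith
  rw [srwSqMom_abs_Dhat_pow_even_single_eq hd l hij m]
  exact add_le_add (div_le_div_of_nonneg_right (add_le_add h0 (h2'.trans h2)) hd0.le)
    (mul_le_mul_of_nonneg_left (h11'.trans h11) hcoef)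

/-! ### The `l = 0` weight is the unit weight -/

/-- `Tw^{|D̂|^0}_n = Tw^{1}_n`. [cite: FitznerVanDerHofstad2016NoBLE, (3.34) p. 1071] -/
theorem srwTwist_abs_Dhat_pow_zero (n : ℕ) (x : Fin d → ℤ) (β : ℝ) :
    srwTwist d n (fun k => |Dhat d k| ^ 0) x β = srwTwist d n (fun _ => 1) x β := by
  simp only [pow_zero]

/-- `Sq^{|D̂|^0}_n = Sq^{1}_n`. [cite: FitznerVanDerHofstad2016NoBLE, (3.34) p. 1071, (5.7) p. 1091] -/
theorem srwSqMom_abs_Dhat_pow_zero (n : ℕ) (x : Fin d → ℤ) :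
    srwSqMom d n (fun k => |Dhat d k| ^ 0) x = srwSqMom d n (fun _ => 1) x := by
  simp only [pow_zero]

/-- The unit-weight mass is the plain seed at the origin: `Tw^{1}_n(x; 0) = I_{n,0}(0)`.
[cite: FitznerVanDerHofstad2016NoBLE, (3.34)–(3.35) p. 1071] -/
theorem srwTwist_one_zero_eq_srwI (n : ℕ) (x : Fin d → ℤ) :
    srwTwist d n (fun _ => 1) x 0 = srwI d n 0 0 := by
  rw [srwTwist, srwI]
  congr 1
  refine integral_congr_ae (ae_of_all _ fun k => ?_)
  simp only [zero_mul, Real.cos_zero, mul_one, pow_zero, DhatSym_zero, one_mul]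

/-! ### The m-uniform `K_{n,0}` row, assembled -/

/-- **m-uniform `K_{n,0}` row.** For `n ≥ 1`, `d ≥ 2n+1`, `i ≠ j`, a majorant with `0 ≤ c`, a cut `M` and
EVERY `m` with `|m| ≥ M`: from `Tlo ≤ I_{n,0}(0) ≤ Thi`, `I_{n,0}(2M e_i) ≤ Ī₂`, `I_{n,0}(M e_i + M e_j) ≤ Ī₁₁`
and, per abscissa, a uniform device output `|Tw^{1}_n(m e_i; b_r) − Q_r·I_{n,0}(0)| ≤ E_r`
(`SrwTwistTruncationSeeds`, `J = 0`; `Q_r ≈ J_0(b_r/d)^d`):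
`K_{n,0}(m e_i) ≤ max(B Tlo, B Thi) + c·((Thi + Ī₂)/(2d) + ((d−1)/d) Ī₁₁) + Σ_r (max(a_r Q_r Tlo, a_r Q_r Thi) + |a_r| E_r)`.
[cite: FitznerVanDerHofstad2016NoBLE, (3.36) p. 1071; (5.4)–(5.9) pp. 1091–1092, Lemma 5.1 p. 1093] -/
theorem srwK_zero_single_le_uniform_of_trigMajorant {n : ℕ} (hn : 1 ≤ n) (hd : 2 * n + 1 ≤ d)
    {i j : Fin d} (hij : i ≠ j) {R : ℕ} (B c : ℝ) (a b : Fin R → ℝ)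
    (hmaj : ∀ t ∈ Set.Icc (-1 : ℝ) 1, |t| ≤ B + c * t ^ 2 + ∑ r, a r * Real.cos (b r * t))
    (hc : 0 ≤ c) (M : ℕ) {m : ℤ} (hM : M ≤ m.natAbs) {Tlo Thi I2 I11 : ℝ} {Q E : Fin R → ℝ}
    (hT : Tlo ≤ srwI d n 0 0 ∧ srwI d n 0 0 ≤ Thi)
    (h2 : srwI d n 0 (Pi.single i (2 * (M : ℤ))) ≤ I2)
    (h11 : srwI d n 0 (Pi.single i (M : ℤ) + Pi.single j (M : ℤ)) ≤ I11)
    (hr : ∀ r, |srwTwist d n (fun _ => 1) (Pi.single i m) (b r) - Q r * srwI d n 0 0| ≤ E r) :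
    srwK d n 0 (Pi.single i m)
      ≤ max (B * Tlo) (B * Thi) + c * ((Thi + I2) / (2 * d) + ((d : ℝ) - 1) / d * I11)
        + ∑ r, (max (a r * Q r * Tlo) (a r * Q r * Thi) + |a r| * E r) := by
  have hK := srwK_le_of_trigMajorant hd 0 (Pi.single i m) B c a b hmaj
  simp only [srwTwist_abs_Dhat_pow_zero, srwSqMom_abs_Dhat_pow_zero, srwTwist_one_zero_eq_srwI] at hK
  have hS : srwSqMom d n (fun _ => (1 : ℝ)) (Pi.single i m)
      ≤ (Thi + I2) / (2 * d) + ((d : ℝ) - 1) / d * I11 := by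
    have h := srwSqMom_abs_Dhat_pow_even_single_le_of_le hn hd 0 hij M hM hT.2 h2 h11
    simpa only [mul_zero, srwSqMom_abs_Dhat_pow_zero] using h
  exact row_le_of_uniform hK hc hT hS hr

/-- **m-uniform `K_{n,0}` row, literal coefficients and rational inputs.** With `gset` and
`Tlo, Thi, Ī₂, Ī₁₁, Q_r, E_r ∈ ℚ`, for every `|m| ≥ M`:
`K_{n,0}(m e_i) ≤ ((max(B Tlo, B Thi) + c((Thi + Ī₂)/(2d) + ((d−1)/d) Ī₁₁) + Σ_{r<6}(max(a_r Q_r Tlo, a_r Q_r Thi) + |a_r| E_r) : ℚ) : ℝ)`.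
[cite: FitznerVanDerHofstad2016NoBLE, (3.36) p. 1071; (5.4)–(5.9) pp. 1091–1092; §5.1.2 (5.11)–(5.16) pp. 1091–1092] -/
theorem srwK_zero_single_le_uniform_gset_cast {n : ℕ} (hn : 1 ≤ n) (hd : 2 * n + 1 ≤ d)
    {i j : Fin d} (hij : i ≠ j) (M : ℕ) {m : ℤ} (hM : M ≤ m.natAbs)
    {Tlo Thi I2 I11 : ℚ} {Q E : Fin 6 → ℚ}
    (hT : (Tlo : ℝ) ≤ srwI d n 0 0 ∧ srwI d n 0 0 ≤ (Thi : ℝ))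
    (h2 : srwI d n 0 (Pi.single i (2 * (M : ℤ))) ≤ (I2 : ℝ))
    (h11 : srwI d n 0 (Pi.single i (M : ℤ) + Pi.single j (M : ℤ)) ≤ (I11 : ℝ))
    (hr : ∀ r, |srwTwist d n (fun _ => 1) (Pi.single i m) (gsetB r) - (Q r : ℝ) * srwI d n 0 0|
      ≤ (E r : ℝ)) :
    srwK d n 0 (Pi.single i m)
      ≤ ((max (MajCert.gset.B * Tlo) (MajCert.gset.B * Thi)
          + MajCert.gset.c * ((Thi + I2) / (2 * d) + ((d : ℚ) - 1) / d * I11)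
          + ∑ r : Fin 6, (max (MajCert.gset.a r * Q r * Tlo) (MajCert.gset.a r * Q r * Thi)
            + |MajCert.gset.a r| * E r) : ℚ) : ℝ) := by
  have h := srwK_zero_single_le_uniform_of_trigMajorant hn hd hij _ _ gsetA gsetB abs_le_trigMaj_gset
    gset_c_nonneg M hM (Q := fun r => (Q r : ℝ)) (E := fun r => (E r : ℝ)) hT h2 h11 hr
  simp only [gsetA] at h
  push_cast
  exact h

end Literature.Probability.FitznerVanDerHofstad2017

end
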